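import Mathlib.LinearAlgebra.Matrix.Adjugate
import Mathlib.LinearAlgebra.Matrix.Trace
import Mathlib.Algebra.MvPolynomial.Basic

/-!
# Route RigidityForcesSymmetry — `GrenetFirstOrderRankRigid` (item stmt-ValiantsHypothesis-21029),
line `grenet_gauge`: stub `stub_linearRigid`, step 1 — reduction to homogeneous directions

For the crux line `Cruxes/GrenetFirstOrderRankRigid/Lines/grenet_gauge.lean` (blueprint
`Lines/grenet_gauge-stub_linearRigid-PROOF.md`, §1).  The stub `stub_linearRigid` says: a direction
`(Λ', A')` at an affine pencil `x̃ = Λ + Σ_v x_v A_v` which is Zariski-tangent to `{det = const}`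
(`tr(adj x̃ · x̃') = 0`), tangent to the rank stratum (`A'_v (ker A_v) ⊆ im A_v`) and whose constant
part is a TRACE-BALANCED gauge direction (`Λ' = P₀Λ - ΛQ₀`, `tr P₀ = tr Q₀`) is a gauge direction.
This file reduces that statement, for ANY pencil over any commutative ring, to its HOMOGENEOUS case
(`Λ' = 0`):

* `trace_adjugate_mul_gauge` — `tr(adj X · (P X - X Q)) = (tr P - tr Q) · det X`; so subtracting the
  balanced gauge direction `P₀ x̃ - x̃ Q₀` keeps tangency (`pencil_gauge_decomposition`,
  `trace_adjugate_pencil_gauge`), and it keeps the rank constraint (`rankConstraint_sub_gauge`);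
* `linearRigid_of_homogeneous` — hence, if every HOMOGENEOUS tangent rank-constrained direction
  `Σ_v x_v A''_v` is of the form `(P A_v - A_v Q)_v` with `P Λ = Λ Q`, the stub's conclusion holds
  for every direction satisfying its three hypotheses (take `(P₀ + P, Q₀ + Q)`).

No new definitions; the pencil is written out as `Λ.map C + Σ_v X v • (A v).map C` exactly as in
the route file.  VP ≠ VNP is not moved by this file (linear algebra for a first-order statement
about one explicit matrix family).
-/

noncomputable section

open MvPolynomial Matrix Finset

namespace Summit.ValiantsHypothesis.Theorems.RigidityForcesSymmetry.GrenetGauge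

section Gauge

variable {R : Type*} [CommRing R] {ι : Type*} [Fintype ι] [DecidableEq ι]

/-- **The tangency defect of a gauge direction**: `tr(adj X · (P X - X Q)) = (tr P - tr Q) · det X`
(`adj X · X = X · adj X = det X · 1` and cyclicity of the trace). [folklore] -/
theorem trace_adjugate_mul_gauge (X P Q : Matrix ι ι R) :
    (X.adjugate * (P * X - X * Q)).trace = (P.trace - Q.trace) * X.det := by
  have h1 : (X.adjugate * (P * X)).trace = X.det * P.trace := by
    rw [← Matrix.mul_assoc, Matrix.trace_mul_comm, ← Matrix.mul_assoc, Matrix.mul_adjugate,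
      Matrix.smul_mul, Matrix.one_mul, Matrix.trace_smul, smul_eq_mul]
  have h2 : (X.adjugate * (X * Q)).trace = X.det * Q.trace := by
    rw [← Matrix.mul_assoc, Matrix.adjugate_mul, Matrix.smul_mul, Matrix.one_mul, Matrix.trace_smul,
      smul_eq_mul]
  rw [Matrix.mul_sub, Matrix.trace_sub, h1, h2]
  ring

end Gauge

section Pencil

variable {k : Type*} [CommRing k] {σ ι : Type*} [Fintype σ] [Fintype ι] [DecidableEq ι]

omit [DecidableEq ι] in
/-- Left multiplication of an affine pencil by a constant matrix. [folklore] -/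
theorem map_C_mul_pencil (P Λ : Matrix ι ι k) (A : σ → Matrix ι ι k) :
    P.map (C : k →+* MvPolynomial σ k) * (Λ.map C + ∑ v, (X v : MvPolynomial σ k) • (A v).map C)
      = (P * Λ).map C + ∑ v, (X v : MvPolynomial σ k) • (P * A v).map C := by
  rw [Matrix.mul_add, Matrix.map_mul, Finset.mul_sum]
  congr 1
  refine Finset.sum_congr rfl fun v _ => ?_
  rw [Matrix.mul_smul, Matrix.map_mul]

omit [DecidableEq ι] in
/-- Right multiplication of an affine pencil by a constant matrix. [folklore] -/
theorem pencil_mul_map_C (Q Λ : Matrix ι ι k) (A : σ → Matrix ι ι k) :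
    (Λ.map C + ∑ v, (X v : MvPolynomial σ k) • (A v).map C) * Q.map (C : k →+* MvPolynomial σ k)
      = (Λ * Q).map C + ∑ v, (X v : MvPolynomial σ k) • (A v * Q).map C := by
  rw [Matrix.add_mul, Matrix.map_mul, Finset.sum_mul]
  congr 1
  refine Finset.sum_congr rfl fun v _ => ?_
  rw [Matrix.smul_mul, Matrix.map_mul]

omit [DecidableEq ι] in
/-- **Gauge decomposition of a direction.** If `Λ' = P₀ Λ - Λ Q₀` then the direction pencil
`Λ' + Σ x_v A'_v` is the gauge direction `P₀ x̃ - x̃ Q₀` plus the HOMOGENEOUS pencil of the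
corrected coefficient matrices `A'_v - (P₀ A_v - A_v Q₀)`. [folklore] -/
theorem pencil_gauge_decomposition (Λ Λ' P₀ Q₀ : Matrix ι ι k) (A A' : σ → Matrix ι ι k)
    (hΛ' : Λ' = P₀ * Λ - Λ * Q₀) :
    Λ'.map (C : k →+* MvPolynomial σ k) + ∑ v, (X v : MvPolynomial σ k) • (A' v).map C
      = (P₀.map (C : k →+* MvPolynomial σ k) * (Λ.map C + ∑ v, (X v : MvPolynomial σ k) • (A v).map C)
          - (Λ.map C + ∑ v, (X v : MvPolynomial σ k) • (A v).map C) * Q₀.map (C : k →+* MvPolynomial σ k))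
        + ∑ v, (X v : MvPolynomial σ k) • (A' v - (P₀ * A v - A v * Q₀)).map C := by
  rw [map_C_mul_pencil, pencil_mul_map_C, hΛ', Matrix.map_sub _ (map_sub C)]
  have h : ∀ v : σ, (X v : MvPolynomial σ k) • (A' v - (P₀ * A v - A v * Q₀)).map (C : k →+* MvPolynomial σ k)
      = (X v : MvPolynomial σ k) • (A' v).map C
        - ((X v : MvPolynomial σ k) • (P₀ * A v).map C - (X v : MvPolynomial σ k) • (A v * Q₀).map C) := by
    intro v
    rw [Matrix.map_sub _ (map_sub C), Matrix.map_sub _ (map_sub C), smul_sub, smul_sub]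
  simp_rw [h]
  rw [Finset.sum_sub_distrib, Finset.sum_sub_distrib]
  abel

/-- **Tangency is insensitive to a trace-balanced gauge direction**: with `Λ' = P₀ Λ - Λ Q₀` and
`tr P₀ = tr Q₀`, `tr(adj x̃ · (Λ' + Σ x_v A'_v)) = tr(adj x̃ · Σ x_v (A'_v - (P₀ A_v - A_v Q₀)))`.
[folklore] -/
theorem trace_adjugate_pencil_gauge (Λ Λ' P₀ Q₀ : Matrix ι ι k) (A A' : σ → Matrix ι ι k)
    (hΛ' : Λ' = P₀ * Λ - Λ * Q₀) (htr : P₀.trace = Q₀.trace) :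
    ((Λ.map C + ∑ v, (X v : MvPolynomial σ k) • (A v).map C).adjugate
        * (Λ'.map C + ∑ v, (X v : MvPolynomial σ k) • (A' v).map C)).trace
      = ((Λ.map C + ∑ v, (X v : MvPolynomial σ k) • (A v).map C).adjugate
        * (∑ v, (X v : MvPolynomial σ k) • (A' v - (P₀ * A v - A v * Q₀)).map (C : k →+* MvPolynomial σ k))).trace := by
  rw [pencil_gauge_decomposition Λ Λ' P₀ Q₀ A A' hΛ', Matrix.mul_add, Matrix.trace_add,
    trace_adjugate_mul_gauge, ← AddMonoidHom.map_trace (C : k →+* MvPolynomial σ k),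
    ← AddMonoidHom.map_trace (C : k →+* MvPolynomial σ k)]
  simp [htr]

omit [Fintype σ] [DecidableEq ι] in
/-- **The rank constraint is insensitive to a gauge direction**: if `A'_v (ker A_v) ⊆ im A_v` then the
same holds for `A'_v - (P₀ A_v - A_v Q₀)` (`(P₀ A_v - A_v Q₀) w = -A_v (Q₀ w)` on `ker A_v`). [folklore] -/
theorem rankConstraint_sub_gauge (P₀ Q₀ : Matrix ι ι k) (A A' : σ → Matrix ι ι k)
    (hC : ∀ v w, (A v).mulVec w = 0 → ∃ u, (A' v).mulVec w = (A v).mulVec u) :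
    ∀ v w, (A v).mulVec w = 0 → ∃ u, (A' v - (P₀ * A v - A v * Q₀)).mulVec w = (A v).mulVec u := by
  intro v w hw
  obtain ⟨u, hu⟩ := hC v w hw
  refine ⟨u + Q₀.mulVec w, ?_⟩
  rw [Matrix.sub_mulVec, Matrix.sub_mulVec, hu, ← Matrix.mulVec_mulVec, ← Matrix.mulVec_mulVec, hw,
    Matrix.mulVec_zero, Matrix.mulVec_add]
  abel

/-- **Reduction of `stub_linearRigid` to homogeneous directions.**  Let `x̃ = Λ + Σ_v x_v A_v` be any
affine pencil.  Suppose every HOMOGENEOUS direction `Σ_v x_v A''_v` that is Zariski-tangent to the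
determinant (`tr(adj x̃ · Σ x_v A''_v) = 0`) and tangent to the rank stratum (`A''_v (ker A_v) ⊆ im A_v`)
is a gauge direction `(P A_v - A_v Q)_v` with `P Λ = Λ Q`.  Then every direction `(Λ', A')` that is
tangent, rank-constrained and has a trace-balanced gauge constant part `Λ' = P₀ Λ - Λ Q₀`,
`tr P₀ = tr Q₀`, is a gauge direction: `Λ' = P Λ - Λ Q`, `A'_v = P A_v - A_v Q` (with `P = P₀ + P₁`,
`Q = Q₀ + Q₁`).  This is §1 of the blueprint of the line `grenet_gauge`. [folklore] -/
theorem linearRigid_of_homogeneous (Λ : Matrix ι ι k) (A : σ → Matrix ι ι k)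
    (hHom : ∀ A'' : σ → Matrix ι ι k,
      ((Λ.map (C : k →+* MvPolynomial σ k) + ∑ v, (X v : MvPolynomial σ k) • (A v).map C).adjugate
          * (∑ v, (X v : MvPolynomial σ k) • (A'' v).map (C : k →+* MvPolynomial σ k))).trace = 0 →
      (∀ v w, (A v).mulVec w = 0 → ∃ u, (A'' v).mulVec w = (A v).mulVec u) →
      ∃ P Q : Matrix ι ι k, P * Λ = Λ * Q ∧ ∀ v, A'' v = P * A v - A v * Q)
    (Λ' : Matrix ι ι k) (A' : σ → Matrix ι ι k)
    (htr : ((Λ.map (C : k →+* MvPolynomial σ k) + ∑ v, (X v : MvPolynomial σ k) • (A v).map C).adjugate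
        * (Λ'.map C + ∑ v, (X v : MvPolynomial σ k) • (A' v).map C)).trace = 0)
    (hC : ∀ v w, (A v).mulVec w = 0 → ∃ u, (A' v).mulVec w = (A v).mulVec u)
    (h3 : ∃ P Q : Matrix ι ι k, P.trace = Q.trace ∧ Λ' = P * Λ - Λ * Q) :
    ∃ P Q : Matrix ι ι k, Λ' = P * Λ - Λ * Q ∧ ∀ v, A' v = P * A v - A v * Q := by
  obtain ⟨P₀, Q₀, htr₀, hΛ'⟩ := h3
  rw [trace_adjugate_pencil_gauge Λ Λ' P₀ Q₀ A A' hΛ' htr₀] at htr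
  obtain ⟨P₁, Q₁, hΛ₁, hA₁⟩ :=
    hHom (fun v => A' v - (P₀ * A v - A v * Q₀)) htr (rankConstraint_sub_gauge P₀ Q₀ A A' hC)
  refine ⟨P₀ + P₁, Q₀ + Q₁, ?_, fun v => ?_⟩
  · rw [Matrix.add_mul, Matrix.mul_add, hΛ', hΛ₁]
    abel
  · have h := hA₁ v
    rw [sub_eq_iff_eq_add] at h
    rw [h, Matrix.add_mul, Matrix.mul_add]
    abel

end Pencil

end Summit.ValiantsHypothesis.Theorems.RigidityForcesSymmetry.GrenetGauge
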